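import Mathlib
import Summits.ResolutionOfSingularities.ResolutionOfSingularities.Theorems.RadicialJungCleanModelsCleanProp44GammaPrimeAdapted
import Summits.ResolutionOfSingularities.ResolutionOfSingularities.Theorems.RadicialJungCleanModelsCleanProp44SideFamilyGeneralExponents
import HarnessLib

/-!
# Route `RadicialJung`, crux `CleanModels` (stmt-ResolutionOfSingularities-15917), line `Sketch` rev 35, stub 6 `stub_cleanProp44` (X44c):
# CLEAN-PERMISSIBILITY OF THE HORIZONTAL SUCCESSOR `Γ′` AT ITS CLOSED POINTS — the classification with the `w`-side removed from the tangent case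

Seat decomp-res-hand-2 g20 (structural hand): census item (v) of hand-2 g19, ASSEMBLED.  Hand-2 g19's
✓ `cleanPermissibleAt_exceptionalCurve_or_obstruction_of_sides_general` classifies, at a point `x′` of a blowing up, the clean-permissibility of ANY regular
curve germ `N = (e′, z)` inside the exceptional divisor: CLEAN-PERMISSIBLE ∨ CORNER ∨ TANGENT side ∨ BIRTH.  For the blowing up of a clean-permissible CURVE
centre `Y` on a threefold (`(c, w)` adapted, `l = 1`: `w` the parameter along `Y`) and `N = 𝓘_{Γ′,z} = 𝔭_{η′}` the horizontal successor at a closed point `z`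
(`𝔭_{η′} ≠ 𝔪_z`), ✓ `IsBlowup.exists_adapted_triple_gammaPrime` (`…GammaPrimeAdapted.lean`) supplies the adapted regular system `(e′, z_Γ, π♯w)` and the
TRANSVERSALITY of the `w`-side; feeding it to the classification gives:

* `cleanPermissibleAt_gammaPrime_or_obstruction` — at `z`: the line of `π♯G` is CLEAN-PERMISSIBLE for `𝔭_{η′}` ∨ CORNER (two distinct sides through `z`,
  `(e′, s₁, s₂) = 𝔪_z`, neither in `𝔭_{η′}`; one of them may be the `w`-side) ∨ TANGENT CHARGED `c`-SIDE (`π♯c_k = e′·s`, `p ∤ a_k`, `s ∈ (𝔭_{η′} + 𝔪_z²) ∖ 𝔭_{η′}`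
  — the `w`-side is EXCLUDED here) ∨ BIRTH (`p ∣ Σ a_k`, no charged `c`-side through `z`, `p ∣ b`, unit form failing the non-birth test for `𝔭_{η′}`).

Honest framing: OURS (assembly of landed bricks); nothing here proves X44c, any case of `CleanModels`, or resolution of singularities in characteristic `p`.
[cite: CossartPiltant2008, Lemma 4.3 (4)–(5); Prop. 4.4 (proof, p. 10)] [cite: Piltant2013, §2 Axiom 4]
-/

noncomputable section

set_option linter.dupNamespace false -- mandated namespace of this single-conjunct summit

open CategoryTheory AlgebraicGeometry TopologicalSpace IsLocalRing
open Literature.AlgebraicGeometry.Resolution Literature.AlgebraicGeometry.Motives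
open Scheme.IdealSheafData

namespace Summit.ResolutionOfSingularities.ResolutionOfSingularities.Theorems.RadicialJung.CleanModels

variable {p : ℕ} {X X' : Scheme.{0}} [IsIntegral X] [IsIntegral X'] {τ : X' ⟶ X} [IsDominant τ]

set_option maxHeartbeats 800000 in
-- one long statement; the proof is a translation
/-- **Clean-permissibility of `Γ′` at a closed point, classified.**  `X` regular locally Noetherian integral, `τ` the blowing up of the regular irreducible
codimension-`2` centre `Y ⊆ {ord J = μ}` (`μ ≥ 1`), at `x = τ z` a regular system `(c, w)` (`w : Fin 1`, `(c) = 𝓘_{Y,x}`) in which the line of `G` reads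
`u · ∏ c_k^{a_k} · w₀^{b₀}` (ANY exponents), `η′` near over the generic point of `Y` with `η′ ⤳ z`, `𝔭_{η′} ≠ 𝔪_z`, `dim 𝒪_{X′,z} = 3`.  Then for `N = 𝔭_{η′}`:
CLEAN-PERMISSIBLE ∨ CORNER ∨ TANGENT CHARGED `c`-SIDE ∨ BIRTH (as in ✓ `…_or_obstruction_of_sides_general`, the `w`-side being transversal to `Γ′`).
[cite: CossartPiltant2008, Lemma 4.3 (4)–(5)] [cite: Piltant2013, §2 Axiom 4] -/
theorem cleanPermissibleAt_gammaPrime_or_obstruction [Fact p.Prime] [CharP X'.functionField p] [IsLocallyNoetherian X] [IsLocallyNoetherian X']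
    (hX : Scheme.IsRegular X) {Y : Closeds X} (hreg : Scheme.IsRegular (vanishingIdeal Y).subscheme) (hτ : IsBlowup τ (vanishingIdeal Y))
    {J : X.IdealSheafData} {μ : ℕ} (hμ : 1 ≤ μ) (hY : ∀ y ∈ (Y : Set X), idealOrder J y = μ)
    {η' : X'} (hη' : closure {τ η'} = (Y : Set X)) (hcodim : Order.coheight (τ η') = 2)
    (hnear : IsNear τ (vanishingIdeal Y) J μ η') {z : X'} (hz : η' ⤳ z)
    (hne : primeOfSpecializes hz ≠ maximalIdeal (X'.presheaf.stalk z)) {n : ℕ} (c : Fin n → X.presheaf.stalk (τ z))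
    (w : Fin 1 → X.presheaf.stalk (τ z)) (hzw : Ideal.span (Set.range (Fin.append c w)) = maximalIdeal (X.presheaf.stalk (τ z)))
    (hdim : ringKrullDim (X.presheaf.stalk (τ z)) = ((n + 1 : ℕ) : WithBot ℕ∞))
    (hcJ : Ideal.span (Set.range c) = stalkIdeal (vanishingIdeal Y) (τ z))
    {G : X.functionField} {cc : Fin p → X.functionField} (hcc : ∃ j : Fin p, (j : ℕ) ≠ 0 ∧ cc j ≠ 0)
    {u : X.presheaf.stalk (τ z)} (hu : IsUnit u) {a : Fin n → ℕ} {b : Fin 1 → ℕ}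
    (hrep : (∑ j : Fin p, cc j ^ p * G ^ (j : ℕ)) = RatFn.toFunctionField (τ z) (u * (∏ k, c k ^ a k) * ∏ m, w m ^ b m))
    (hdim' : ringKrullDim (X'.presheaf.stalk z) = 3) :
    CleanPermissibleAt p (RatFn.toFunctionField z) (RatFn.functionFieldMap τ G) (primeOfSpecializes hz) ∨
    (∃ e' s₁ s₂ : X'.presheaf.stalk z, Ideal.span {e'} = (stalkIdeal (vanishingIdeal Y) (τ z)).map (τ.stalkMap z).hom ∧ s₁ ≠ s₂ ∧
        ((∃ k, ¬ p ∣ a k ∧ (τ.stalkMap z).hom (c k) = e' * s₁) ∨ (∃ m, ¬ p ∣ b m ∧ (τ.stalkMap z).hom (w m) = s₁)) ∧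
        ((∃ k, ¬ p ∣ a k ∧ (τ.stalkMap z).hom (c k) = e' * s₂) ∨ (∃ m, ¬ p ∣ b m ∧ (τ.stalkMap z).hom (w m) = s₂)) ∧
        Ideal.span ({e', s₁, s₂} : Set (X'.presheaf.stalk z)) = maximalIdeal (X'.presheaf.stalk z) ∧
        s₁ ∉ primeOfSpecializes hz ∧ s₂ ∉ primeOfSpecializes hz) ∨
    (∃ e' s : X'.presheaf.stalk z, Ideal.span {e'} = (stalkIdeal (vanishingIdeal Y) (τ z)).map (τ.stalkMap z).hom ∧
        (∃ k, ¬ p ∣ a k ∧ (τ.stalkMap z).hom (c k) = e' * s) ∧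
        s ∈ maximalIdeal (X'.presheaf.stalk z) ∧ s ∉ primeOfSpecializes hz ∧
        s ∈ primeOfSpecializes hz ⊔ maximalIdeal (X'.presheaf.stalk z) ^ 2) ∨
    (p ∣ ∑ k, a k ∧ (∀ k, ¬ p ∣ a k → Ideal.span {(τ.stalkMap z).hom (c k)} = (stalkIdeal (vanishingIdeal Y) (τ z)).map (τ.stalkMap z).hom) ∧
      (∀ m, p ∣ b m) ∧
      ∃ e' U D : X'.presheaf.stalk z, Ideal.span {e'} = (stalkIdeal (vanishingIdeal Y) (τ z)).map (τ.stalkMap z).hom ∧ IsUnit U ∧ D ≠ 0 ∧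
        (∑ j : Fin p, RatFn.functionFieldMap τ (cc j) ^ p * RatFn.functionFieldMap τ G ^ (j : ℕ)) =
          RatFn.toFunctionField z (U * e' ^ (∑ k, a k) * D ^ p) ∧
        ¬ ((∀ c' : X'.presheaf.stalk z, U - c' ^ p ∉ maximalIdeal (X'.presheaf.stalk z)) ∨
          (∃ c' : X'.presheaf.stalk z, U - c' ^ p ∈ maximalIdeal (X'.presheaf.stalk z) ∧
            U - c' ^ p ∉ primeOfSpecializes hz ⊔ maximalIdeal (X'.presheaf.stalk z) ^ 2) ∨
          (∃ c' : X'.presheaf.stalk z, U - c' ^ p ∈ primeOfSpecializes hz ∧ U - c' ^ p ∉ maximalIdeal (X'.presheaf.stalk z) ^ 2))) := by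
  classical
  haveI hR : IsRegularLocalRing (X.presheaf.stalk (τ z)) := hX _
  -- `w₀ ∈ 𝔪_x` and `𝔪_x ≤ (c) + (w₀)`
  have hrange : Set.range (Fin.append c w) = Set.range c ∪ {w 0} := by
    ext r
    simp only [Set.mem_range, Set.mem_union, Set.mem_singleton_iff]
    constructor
    · rintro ⟨i, rfl⟩
      induction i using Fin.addCases with
      | left i => exact Or.inl ⟨i, by rw [Fin.append_left]⟩
      | right k =>
        right
        rw [Fin.append_right, Subsingleton.elim k 0]
    · rintro (⟨i, rfl⟩ | rfl)
      · exact ⟨Fin.castAdd 1 i, by rw [Fin.append_left]⟩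
      · exact ⟨Fin.natAdd n 0, by rw [Fin.append_right]⟩
  have hwm : w 0 ∈ maximalIdeal (X.presheaf.stalk (τ z)) := by
    rw [← hzw]; exact Ideal.subset_span ⟨Fin.natAdd n 0, by rw [Fin.append_right]⟩
  have hw : maximalIdeal (X.presheaf.stalk (τ z)) ≤ stalkIdeal (vanishingIdeal Y) (τ z) ⊔ Ideal.span {w 0} := by
    rw [← hzw, hrange, Ideal.span_union, hcJ]
  -- the adapted triple at `z`
  obtain ⟨e', zΓ, he', hN, hzz, htr, htrN⟩ :=
    hτ.exists_adapted_triple_gammaPrime hX hreg hμ hY hη' hcodim hnear hz hne hwm hw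
  rw [← hN]
  rcases cleanPermissibleAt_exceptionalCurve_or_obstruction_of_sides_general (p := p) hτ z hR c w hzw hdim hcJ hcc hu hrep hdim' he' hzz with
    hperm | ⟨s₁, s₂, hne12, h1, h2, h𝔪, hN₁, hN₂⟩ | ⟨s, hside, hsm, hsN, hsmem⟩ | ⟨hA, hcharged, hb, U, D, hU, hD, hrep', hnb⟩
  · exact Or.inl hperm
  · exact Or.inr (Or.inl ⟨e', s₁, s₂, he', hne12, h1, h2, h𝔪, hN₁, hN₂⟩)
  · -- the tangent side is a charged `c`-side: the `w`-side is transversal to `Γ′`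
    rcases hside with hc | ⟨m, -, hm⟩
    · exact Or.inr (Or.inr (Or.inl ⟨e', s, he', hc, hsm, hsN, hsmem⟩))
    · exfalso
      rw [Subsingleton.elim m 0] at hm
      rw [← hm, hN] at hsmem
      exact htr hsmem
  · exact Or.inr (Or.inr (Or.inr ⟨hA, hcharged, hb, e', U, D, he', hU, hD, hrep', hnb⟩))

end Summit.ResolutionOfSingularities.ResolutionOfSingularities.Theorems.RadicialJung.CleanModels

end
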